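import Summits.MatrixMultiplication.MatrixMultiplication.Theorems.TetrahedronTensorRectangular
import HarnessLib

/-!
# ConeTensorCore — the squared-spoke cone `W_n = T(K₄; spokes n², rim n)`, its triangle cover
`R₄(W_n) ≤ R(⟨n,n,n⟩)³`, the grouping `R(⟨n⁴,n²,n²⟩) ≤ R₄(W_n)` and the flattening `n⁶ ≤ R₄(W_n)`

(decomp-mm lens 6 «barrier-complement carving», gen 14; kernel of the node `ConeCarving`:
`ω = 2 ⟺ [ω(W) ≤ 6] ∧ [3ω ≤ ω(W)]`, the SPOKE DEFORMATION `s = 2` of the tetrahedron carving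
`TetrahedronCarving` (gen 13, `s = 1`). Companion modules: `ConeTensor` (exponent `ω(W)`, bracket
`6 ≤ ω(W) ≤ 3ω`, exact cut), `ConeTensorResidual` (`T(K₄)_{n·n} = ⟨n,n,n⟩_{rim} · W_n`, hence
`2ω(K₄) ≤ ω + ω(W)` and `TetraNoSaving ⟹ ConeNoSaving`).)

THE OBJECT. `W_n ∈ (F^{(n²)³})^{⊗4}` is the graph tensor (Christandl–Vrana–Zuiddam, arXiv:1609.07476
[CVZ19], Ex. 1.1.2: one EPR pair per edge, regrouped at the vertices) of the WEIGHTED tetrahedron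
with apex `0`: the three spokes `01, 02, 03` carry EPR pairs of size `n²`, the three rim edges
`12, 13, 23` pairs of size `n`. Equivalently `W_n = ⟨n,n,n⟩_{023} ⊠ ⟨n,n,n⟩_{013} ⊠ ⟨n,n,n⟩_{012}`,
the Kronecker product of the three matrix multiplication tensors placed on the triangles through the
apex — which is how it is DEFINED here (`cone`): the product of the three apex factors of the
pointwise triangle factorisation `tetra_sq_apply` of `T(K₄)_{n·n}` (gen 13). It lives in the cubic
format of `tensorRankD` (`d = 4`, side `(n·n)³`, the format of `T(K₄)_{n·n}`); the rim legs ignore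
the second component of their two rim labels (padding a leg by a constant factor `𝟙_{n²}`, which
changes no rank bound below). The fourth factor of `tetra_sq_apply` is the rim triangle, so
`T(K₄)_{n·n} = ⟨n,n,n⟩_{123} · W_n` pointwise (`tetra_sq_eq_rim_mul_cone`).

What is proved here (every field, sorry-free): `cone_eq_sum_cover` / `tensorRankD_cone_le :
R₄(W_n) ≤ R(⟨n,n,n⟩)³` (sub-multiplicativity of rank under `⊠`, CVZ19 Prop. 1.1.16 (proof));
`cone_decomposable`, `tensorRankD_cone_le_pow_nine : R₄(W_n) ≤ n⁹`; the GROUPING `{2,3} | 0 | 1`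
(rim edge `23` frozen): `cone_groupLegs` (the grouped cone is `⟨n⁴, n², n²⟩`) and
`tensorRank_matMulTensor_le_tensorRankD_cone : R(⟨n⁴,n²,n²⟩) ≤ R₄(W_n)`; and from the tree's
flattening bound for `⟨k,m,n⟩` the FLATTENING `pow_six_le_tensorRankD_cone : n⁶ ≤ R₄(W_n)`.
No `sorry`, no new axiom, no instance, no notation, no `Prop`-valued definition.
-/

noncomputable section

-- D-0017 nested layout `Summits/<Summit>/<Sub>/…` with `Sub = Summit` duplicates a namespace component.
set_option linter.dupNamespace false

open scoped BigOperators
open Filter Asymptotics Module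
open Literature.Computability.AlgebraicComplexity
open Summit.MatrixMultiplication.MatrixMultiplication.Theorems.TetrahedronTensor

namespace Summit.MatrixMultiplication.MatrixMultiplication.Theorems.ConeTensor

/-! ## The cone tensor `W_n` and the factorisation `T(K₄)_{n·n} = ⟨n,n,n⟩_{rim} · W_n` -/

section Tensor

variable (F : Type*) [Field F]

/-- **The squared-spoke cone** `W_n = ⟨n,n,n⟩_{023} ⊠ ⟨n,n,n⟩_{013} ⊠ ⟨n,n,n⟩_{012}`: the graph
tensor of `K₄` with spokes `01,02,03` of size `n²` and rim edges `12,13,23` of size `n`, in the cubic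
4-leg format of side `(n·n)³` (leg index = three pair labels `(P₁, P₂)`; a rim leg ignores the second
component of its two rim labels). Defined as the product of the three apex triangle factors of
`tetra_sq_apply` (triangles `{0,2,3}`, `{0,1,3}`, `{0,1,2}`, in this order). (CVZ19, Ex. 1.1.2;
BCKLOSW26, eq. (13)). -/
def cone (n : ℕ) : (Fin 4 → Fin ((n * n) ^ 3)) → F := fun i =>
  matMulTensor F n n n (P₂ (i 0) 1, P₂ (i 0) 2) (P₂ (i 2) 0, P₁ (i 2) 2) (P₁ (i 3) 2, P₂ (i 3) 0) *
  matMulTensor F n n n (P₂ (i 0) 0, P₁ (i 0) 2) (P₂ (i 1) 0, P₁ (i 1) 2) (P₁ (i 3) 1, P₁ (i 3) 0) *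
  matMulTensor F n n n (P₁ (i 0) 0, P₁ (i 0) 1) (P₁ (i 1) 0, P₁ (i 1) 1) (P₁ (i 2) 1, P₁ (i 2) 0)

variable {F}

/-- **`T(K₄)_{n·n} = ⟨n,n,n⟩_{123} · W_n`** pointwise: the tetrahedron at the square level is the
rim triangle times the squared-spoke cone (the fourth factor of `tetra_sq_apply`).
[cite: ChristandlVranaZuiddam2016, Prop. 1.1.26 (proof)] -/
theorem tetra_sq_eq_rim_mul_cone {n : ℕ} (i : Fin 4 → Fin ((n * n) ^ 3)) :
    tetra F (n * n) i =
      matMulTensor F n n n (P₂ (i 1) 1, P₂ (i 1) 2) (P₂ (i 2) 1, P₂ (i 2) 2) (P₂ (i 3) 2, P₂ (i 3) 1) *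
        cone F n i := by
  rw [tetra_sq_apply]
  simp only [cone]
  ring

/-! ## The triangle cover `R₄(W_n) ≤ R(⟨n,n,n⟩)³` -/

/-- The four legs of the cover summand indexed by `l : Fin 3 → Fin r` (one index per apex
triangle `{0,2,3}, {0,1,3}, {0,1,2}`), from a triad decomposition `⟨n,n,n⟩ = ∑_j w_j ⊗ u_j ⊗ v_j`:
at each vertex, the product of the factors of the apex triangles through it.
(CVZ19, Prop. 1.1.16 (proof)). -/
def coneLeg {n r : ℕ} (w u v : Fin r → Fin n × Fin n → F) (l : Fin 3 → Fin r) :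
    Fin 4 → Fin ((n * n) ^ 3) → F :=
  ![fun x => w (l 0) (P₂ x 1, P₂ x 2) * w (l 1) (P₂ x 0, P₁ x 2) * w (l 2) (P₁ x 0, P₁ x 1),
    fun x => u (l 1) (P₂ x 0, P₁ x 2) * u (l 2) (P₁ x 0, P₁ x 1),
    fun x => u (l 0) (P₂ x 0, P₁ x 2) * v (l 2) (P₁ x 1, P₁ x 0),
    fun x => v (l 0) (P₁ x 2, P₂ x 0) * v (l 1) (P₁ x 1, P₁ x 0)]

/-- **The cover decomposition of the cone**: from `⟨n,n,n⟩ = ∑_{j<r} w_j ⊗ u_j ⊗ v_j`,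
`W_n = ∑_{l ∈ [r]^3} ⊗_v coneLeg_l(v)` (`r³` rank-one terms).
[cite: ChristandlVranaZuiddam2016, Prop. 1.1.16 (proof)] -/
theorem cone_eq_sum_cover {n r : ℕ} {w u v : Fin r → Fin n × Fin n → F}
    (hdec : matMulTensor F n n n = ∑ j, triad (w j) (u j) (v j)) :
    ∑ l : Fin 3 → Fin r, rankOneTensor (coneLeg w u v l) = cone F n := by
  classical
  have hMM : ∀ a b c, matMulTensor F n n n a b c = ∑ j : Fin r, w j a * u j b * v j c := by
    intro a b c
    have h := congrFun (congrFun (congrFun hdec a) b) c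
    rw [h, Finset.sum_apply, Finset.sum_apply, Finset.sum_apply]
    rfl
  funext i
  -- the apex triangle terms at the point `i`
  let T : Fin 3 → Fin r → F := ![
    fun j => w j (P₂ (i 0) 1, P₂ (i 0) 2) * u j (P₂ (i 2) 0, P₁ (i 2) 2) * v j (P₁ (i 3) 2, P₂ (i 3) 0),
    fun j => w j (P₂ (i 0) 0, P₁ (i 0) 2) * u j (P₂ (i 1) 0, P₁ (i 1) 2) * v j (P₁ (i 3) 1, P₁ (i 3) 0),
    fun j => w j (P₁ (i 0) 0, P₁ (i 0) 1) * u j (P₁ (i 1) 0, P₁ (i 1) 1) * v j (P₁ (i 2) 1, P₁ (i 2) 0)]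
  calc (∑ l : Fin 3 → Fin r, rankOneTensor (coneLeg w u v l)) i
      = ∑ l : Fin 3 → Fin r, ∏ t, T t (l t) := by
        rw [Finset.sum_apply]
        refine Finset.sum_congr rfl fun l _ => ?_
        rw [rankOneTensor_apply, Fin.prod_univ_four, Fin.prod_univ_three]
        simp only [coneLeg, T, Matrix.cons_val_zero, Matrix.cons_val_one, Matrix.cons_val_two,
          Matrix.cons_val_three, Matrix.head_cons, Matrix.tail_cons]
        ring
    _ = ∏ t, ∑ j, T t j := (Fintype.prod_sum T).symm
    _ = cone F n i := by
        rw [Fin.prod_univ_three]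
        simp only [cone]
        rw [hMM, hMM, hMM]
        simp only [T, Matrix.cons_val_zero, Matrix.cons_val_one, Matrix.cons_val_two,
          Matrix.head_cons, Matrix.tail_cons]

/-- **Cover bound** `R₄(W_n) ≤ R(⟨n,n,n⟩)³` (rank is sub-multiplicative under the Kronecker
product of the three apex triangles). [cite: ChristandlVranaZuiddam2016, Prop. 1.1.16 (proof)] -/
theorem tensorRankD_cone_le (n : ℕ) :
    tensorRankD (cone F n) ≤ tensorRank (matMulTensor F n n n) ^ 3 := by
  classical
  obtain ⟨w, u, v, hdec⟩ := exists_triad_decomposition_tensorRank (matMulTensor F n n n)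
  have hsum := cone_eq_sum_cover hdec
  have hcard : Fintype.card (Fin 3 → Fin (tensorRank (matMulTensor F n n n))) =
      tensorRank (matMulTensor F n n n) ^ 3 := by simp
  rw [← hcard]
  let e := Fintype.equivFin (Fin 3 → Fin (tensorRank (matMulTensor F n n n)))
  refine tensorRankD_le_of_eq_sum (fun k => coneLeg w u v (e.symm k)) ?_
  rw [← hsum]
  exact Fintype.sum_equiv e.symm _ _ (fun _ => rfl)

/-- `W_n` decomposes over rank-one tensors (so `tensorRankD (cone F n)` is a genuine minimum).
[cite: ChristandlVranaZuiddam2016, Ex. 1.1.2] -/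
theorem cone_decomposable (n : ℕ) :
    ∃ s : ℕ, ∃ g : Fin s → ((Fin 4 → Fin ((n * n) ^ 3)) → F),
      (∀ k, g k ∈ rankOneTensors F ((n * n) ^ 3) 4) ∧ ∑ k, g k = cone F n := by
  classical
  obtain ⟨w, u, v, hdec⟩ := exists_triad_decomposition_tensorRank (matMulTensor F n n n)
  let e := Fintype.equivFin (Fin 3 → Fin (tensorRank (matMulTensor F n n n)))
  refine ⟨_, fun k => rankOneTensor (coneLeg w u v (e.symm k)), fun _ => rankOneTensor_mem _, ?_⟩
  rw [← cone_eq_sum_cover hdec]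
  exact Fintype.sum_equiv e.symm _ _ (fun _ => rfl)

/-- A rank-one decomposition of `W_n` of length exactly `R₄(W_n)`. [folklore] -/
theorem exists_rankOne_decomposition_cone (n : ℕ) :
    ∃ u : Fin (tensorRankD (cone F n)) → Fin 4 → Fin ((n * n) ^ 3) → F,
      ∑ k, rankOneTensor (u k) = cone F n := by
  classical
  obtain ⟨g, hg, hs⟩ := sComplexity_spec (cone_decomposable (F := F) n)
  simp only [rankOneTensors, Set.mem_range] at hg
  choose u hu using hg
  have h : ∑ k, rankOneTensor (u k) = ∑ k, g k := Finset.sum_congr rfl fun k _ => hu k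
  exact ⟨u, h.trans hs⟩

/-- **Trivial upper bound** `R₄(W_n) ≤ n⁹` (cover with the standard algorithm `R(⟨n,n,n⟩) ≤ n³`;
= the number of edge labellings `(n²)³ · n³`). [cite: ChristandlVranaZuiddam2016, §1.2 (table)] -/
theorem tensorRankD_cone_le_pow_nine (n : ℕ) : tensorRankD (cone F n) ≤ n ^ 9 :=
  calc tensorRankD (cone F n) ≤ tensorRank (matMulTensor F n n n) ^ 3 := tensorRankD_cone_le n
    _ ≤ (n * n * n) ^ 3 := Nat.pow_le_pow_left (tensorRank_matMulTensor_le F n n n) 3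
    _ = n ^ 9 := by ring

end Tensor

/-! ## Grouping `{2,3} | 0 | 1`: `R(⟨n⁴, n², n²⟩) ≤ R₄(W_n)` and the flattening `n⁶ ≤ R₄(W_n)` -/

section Grouping

variable {F : Type*} [Field F]

/-- Apex leg of the grouping: vertex `0` reads, off the point `a = (κ, ν)` of `⟨N⁴, N², N²⟩`
(`κ = (e₀₂, e₀₃)` two pair labels, `ν = e₀₁` a pair label), the label triple `(e₀₁, e₀₂, e₀₃)`. -/
def leg₀ {N : ℕ} (a : Fin (N * N * (N * N)) × Fin (N * N)) : Fin ((N * N) ^ 3) :=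
  enc a.2 (finProdFinEquiv.symm a.1).1 (finProdFinEquiv.symm a.1).2

/-- Leg of vertex `1`: off `c = (μ, ν)` (`μ = (e₁₂, e₁₃) ∈ [N]²`, `ν = e₀₁`), the triple
`(e₀₁, (e₁₂, 0), (e₁₃, 0))` (dummy second rim components `0`). -/
def leg₁ {N : ℕ} [NeZero N] (c : Fin (N * N) × Fin (N * N)) : Fin ((N * N) ^ 3) :=
  enc c.2 (finProdFinEquiv ((finProdFinEquiv.symm c.1).1, (0 : Fin N)))
    (finProdFinEquiv ((finProdFinEquiv.symm c.1).2, (0 : Fin N)))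

/-- Leg of vertex `2`: off `b = (κ', μ')`, the triple `(e₀₂, (e₁₂, 0), (0, 0))` (rim edge `23`
frozen to `0`). -/
def leg₂ {N : ℕ} [NeZero N] (b : Fin (N * N * (N * N)) × Fin (N * N)) : Fin ((N * N) ^ 3) :=
  enc (finProdFinEquiv.symm b.1).1 (finProdFinEquiv ((finProdFinEquiv.symm b.2).1, (0 : Fin N)))
    (finProdFinEquiv ((0 : Fin N), (0 : Fin N)))

/-- Leg of vertex `3`: off `b = (κ', μ')`, the triple `(e₀₃, (e₁₃, 0), (0, 0))`. -/
def leg₃ {N : ℕ} [NeZero N] (b : Fin (N * N * (N * N)) × Fin (N * N)) : Fin ((N * N) ^ 3) :=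
  enc (finProdFinEquiv.symm b.1).2 (finProdFinEquiv ((finProdFinEquiv.symm b.2).2, (0 : Fin N)))
    (finProdFinEquiv ((0 : Fin N), (0 : Fin N)))

/-- The four legs of `W_N` read off a point `(a, b, c)` of `⟨N⁴, N², N²⟩` under the grouping
`{2,3} | 0 | 1` (party `0` = slot pair `(κ, ν)`, the group `{2,3}` = `(κ, μ)`, party `1` = `(μ, ν)`;
spoke `01 = ν ∈ [N²]`, spokes `(02, 03) = κ ∈ [N⁴]`, rim edges `(12, 13) = μ ∈ [N²]`, rim edge `23`
frozen). -/
def groupLegs {N : ℕ} [NeZero N] (a : Fin (N * N * (N * N)) × Fin (N * N))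
    (b : Fin (N * N * (N * N)) × Fin (N * N)) (c : Fin (N * N) × Fin (N * N)) :
    Fin 4 → Fin ((N * N) ^ 3) :=
  ![leg₀ a, leg₁ c, leg₂ b, leg₃ b]

/-- **The grouped cone is `⟨N⁴, N², N²⟩`**: at the legs `groupLegs a b c`, `W_N` takes the value
`⟨N⁴, N², N²⟩(a, b, c)`. [folklore] -/
theorem cone_groupLegs {N : ℕ} [NeZero N] (a : Fin (N * N * (N * N)) × Fin (N * N))
    (b : Fin (N * N * (N * N)) × Fin (N * N)) (c : Fin (N * N) × Fin (N * N)) :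
    cone F N (groupLegs a b c) = matMulTensor F (N * N * (N * N)) (N * N) (N * N) a b c := by
  have e : ∀ x y : Fin (N * N), x = y ↔
      ((finProdFinEquiv.symm x).1 = (finProdFinEquiv.symm y).1 ∧
        (finProdFinEquiv.symm x).2 = (finProdFinEquiv.symm y).2) := fun x y => by
    rw [← Prod.ext_iff, Equiv.apply_eq_iff_eq]
  have e' : ∀ x y : Fin (N * N * (N * N)), x = y ↔
      ((finProdFinEquiv.symm x).1 = (finProdFinEquiv.symm y).1 ∧
        (finProdFinEquiv.symm x).2 = (finProdFinEquiv.symm y).2) := fun x y => by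
    rw [← Prod.ext_iff, Equiv.apply_eq_iff_eq]
  simp only [cone, matMulTensor, ite_one_zero_mul_ite]
  refine if_congr ?_ rfl rfl
  simp only [groupLegs, leg₀, leg₁, leg₂, leg₃, P₁, P₂, symm_enc, Equiv.symm_apply_apply,
    Matrix.cons_val_zero, Matrix.cons_val_one, Matrix.cons_val_two, Matrix.cons_val_three,
    Matrix.head_cons, Matrix.tail_cons, e' a.1 b.1, e a.2 c.2, e b.2 c.1,
    e (finProdFinEquiv.symm a.1).1 (finProdFinEquiv.symm b.1).1,
    e (finProdFinEquiv.symm a.1).2 (finProdFinEquiv.symm b.1).2, true_and,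
    @eq_comm _ (finProdFinEquiv.symm c.1).1 (finProdFinEquiv.symm b.2).1,
    @eq_comm _ (finProdFinEquiv.symm c.1).2 (finProdFinEquiv.symm b.2).2]
  tauto

/-- **Grouping lower-bound transfer** `R(⟨N⁴, N², N²⟩) ≤ R₄(W_N)` (`N ≥ 1`): a rank-one
decomposition `W_N = ∑_k ⊗_v u_k(v)` restricts along `groupLegs` to the triad decomposition
`⟨N⁴,N²,N²⟩ = ∑_k u_k(0) ∘ leg₀ ⊗ (u_k(2) ∘ leg₂ · u_k(3) ∘ leg₃) ⊗ u_k(1) ∘ leg₁`. [folklore] -/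
theorem tensorRank_matMulTensor_le_tensorRankD_cone (N : ℕ) [NeZero N] :
    tensorRank (matMulTensor F (N * N * (N * N)) (N * N) (N * N)) ≤ tensorRankD (cone F N) := by
  classical
  obtain ⟨u, hu⟩ := exists_rankOne_decomposition_cone (F := F) N
  refine tensorRank_le_of_eq_sum (fun k a => u k 0 (leg₀ a))
    (fun k b => u k 2 (leg₂ b) * u k 3 (leg₃ b)) (fun k c => u k 1 (leg₁ c)) ?_
  funext a b c
  have hpt := congrFun hu (groupLegs a b c)
  rw [Finset.sum_apply, cone_groupLegs] at hpt
  rw [← hpt, Finset.sum_apply, Finset.sum_apply, Finset.sum_apply]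
  refine Finset.sum_congr rfl fun k _ => ?_
  rw [rankOneTensor_apply, Fin.prod_univ_four, triad_apply]
  simp only [groupLegs, Matrix.cons_val_zero, Matrix.cons_val_one, Matrix.cons_val_two,
    Matrix.cons_val_three, Matrix.head_cons, Matrix.tail_cons]
  ring

/-- **Flattening lower bound** `N⁶ ≤ R₄(W_N)` for `N ≥ 1` (the `0 | {1,2,3}` cut of the cone has
`(n²)³` EPR pairs across it; here: grouping + the flattening `k·n ≤ R(⟨k,m,n⟩)` of `⟨N⁴,N²,N²⟩`).
[cite: ChristandlVranaZuiddam2016, §1.2 (eq. (flat))] -/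
theorem pow_six_le_tensorRankD_cone (N : ℕ) [NeZero N] : N ^ 6 ≤ tensorRankD (cone F N) := by
  haveI : NeZero (N * N) := ⟨mul_ne_zero (NeZero.ne N) (NeZero.ne N)⟩
  calc N ^ 6 = N * N * (N * N) * (N * N) := by ring
    _ ≤ tensorRank (matMulTensor F (N * N * (N * N)) (N * N) (N * N)) :=
        mul_le_tensorRank_matMulTensor F _ _ _
    _ ≤ tensorRankD (cone F N) := tensorRank_matMulTensor_le_tensorRankD_cone N

/-- The flattening bound for all `N` (trivial at `N = 0`). [cite: ChristandlVranaZuiddam2016, §1.2 (eq. (flat))] -/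
theorem pow_six_le_tensorRankD_cone' (N : ℕ) : N ^ 6 ≤ tensorRankD (cone F N) := by
  rcases Nat.eq_zero_or_pos N with rfl | hN
  · simp
  · haveI : NeZero N := ⟨hN.ne'⟩
    exact pow_six_le_tensorRankD_cone N

end Grouping

end Summit.MatrixMultiplication.MatrixMultiplication.Theorems.ConeTensor

end
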